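import Literature.MathematicalPhysics.QuantumFieldTheory.Balaban1983to89.B9Eq342SupNormDecayFromBlockDecay
import Literature.MathematicalPhysics.QuantumFieldTheory.Balaban1983to89.B9Eq342GreenPrimeSupBound
import Literature.MathematicalPhysics.QuantumFieldTheory.Balaban1983to89.B9Eq324DeltaPrimeATower
import Literature.MathematicalPhysics.QuantumFieldTheory.Balaban1983to89.B9Eq342TowerBigBlocks

/-!
# `Balaban1983to89.B9Eq342GreenPrimeTowerSupBoundDecay` — T. Bałaban, *Propagators for lattice gauge theories in a background field*, Commun. Math. Phys.
# **99** (1985) 389–434 [Balaban1985BackgroundPropagators] Thm 3.1 (3.42) p. 397, FIRST ENTRY **WITH ITS DECAY FACTOR**, AT `k = n+1` AVERAGING LEVELS,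
# FOR PRINT's `G′_k(U) = (Δ′_{a′,k}(U))⁻¹` ((3.24)–(3.25) p. 394 with the composite averaging `Q′_k(U)` of (3.19) p. 393; the cell's
# `B9Eq324DeltaPrimeATower.GpOfUk` on the tower torus `T_{(L^{n+1}m)}`): **for a source `f` supported in ONE BIG BLOCK `B^k(v)` (side `L^{n+1}`) and an
# output site `x₀`, `‖(G′_k(U)f)(x₀)‖ ≤ (B₁ + B₂)·e^{−κ′·d_m(Πx₀, v)}·sup|f|`, `B₁ = (1 + p₂C_E√μ)·M·Σ_{l<k}λ^{−(l+1)}`, `B₂ = C₃·√(M·K_d(κ₁−2κ′))·C_E·√μ`,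
# and the ROW SUM over the source big blocks `‖(G′_k(U)f)(x₀)‖ ≤ (B₁+B₂)·K_d(κ′)·sup|f|` for EVERY `f` — the `L^∞ → L^∞` bound of `G′_k(U)` — with every
# analytic input a DISPLAYED letter in the shape its supplier prints** — the TOWER TWIN of `B9Eq342GreenPrimeSupBoundDecay` (storey (D) of the NE9 owner's
# sup-norm programme, plan v10 §5; `t4/b2b-balaban-t4-ne9-p1/g90/STOREY-D-ASSEMBLY.md` §3 «the row the (N)-reading actually consumes»), composing BY NAME
# ne9-leaf-06 g71's ABSTRACT any-`π` composition `B9Eq342SupNormDecayFromBlockDecay.norm_apply_le_decay_of_letters` with ne9-leaf-03 g71's big-block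
# geometry `B9Eq342TowerBigBlocks` and this lineage's Kato form of (3.23) at the tower

statement-level skeleton of published theorems with citation tags; proofs where landed; nothing here is a claim about the Yang–Mills mass gap

CITATION HEADER (lean-in-tree rule).  Audit cell `pub-balaban`, sub-cell `t4`, BINDER row NE9; filed by the NE9 BINDER-row OWNER lineage
`b2b-balaban-t4-ne9-p1` (gen 91) as the tower item of plan v10 storey (D).  Composed BY NAME: ne9-leaf-06 g71's `B9Eq342SupNormDecayFromBlockDecay`
(`block_apply_eq_self_of_support`, `norm_apply_le_decay_of_letters` — sites `X`, blocks `Y`, ANY block map `π`, ANY pseudo-metric `δ`), ne9-leaf-03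
g71's `B9Eq342TowerBigBlocks` (`bigBlock_apply_val`: the big-block map `Π = blockCoord (L^{n+1}) m ∘ siteCast`), ne9-leaf-01's `B9Eq349BlockMultipliers`
(`sum_block_apply`), this lineage's `B9Eq342GreenPrimeSupBound` §0 (transporter letters) and `B9Eq323KatoDomination.equiv_covLaplaceSiteK_eq_sum` (the
weighted-graph form of `Δ^η_U`), the cell's `B9Eq324DeltaPrimeATower` (`laplacePrimeAk`, `GpOfUk`), `B4Sect5Torus.torusSum_le`.  Sources READ first-hand
(`paper:balaban1985-cmp99-background-propagators`, journal page = PDF page + 388): p. 393 (3.19), p. 394 (3.23)–(3.25), p. 397 Thm 3.1 (3.39)–(3.42),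
p. 399 (3.49), pp. 415–416 (the random-walk proof and Thm 3.10 — NOT reproduced; this file is the cell's energy∕positivity substitute, storey (D)).

THE PRINT (verbatim, p. 397, Thm 3.1).  *«There exist positive constants δ₀, B₀ dependent on d and B₀ dependent on L also, … such that for arbitrary
j, k, 0 ≤ j ≤ k, and arbitrary U satisfying (3.35)–(3.37) we have |(G(U)λ)(x)|, |(∇^η_U G(U)λ)(x)|, |(Δ^η_U G(U)λ)(x)| ≤ B₀e^{−δ₀d(y,y′)}|λ| (3.42)
for x ∈ Δ(y), y, y′ ∈ T^{(j)}, λ with supp λ ⊂ Δ(y′)»* — here the FIRST entry, `j = k = n+1` (`L^jη = 1`), for print's `G′(U)`; `Δ(y)` = the unit block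
over `y ∈ T_m`, i.e. the BIG block of `(L^{n+1})^d` fine sites of the tower's top torus.

WHAT IS PROVED (sorry-free; proof lane — no `def`, no `Prop` placeholder, nothing of [B9] asserted hypothesis-free; [folklore] = plumbing + one composition).
* §0 `bigBlock_eq_iff` (the big-block map `Π` versus ne9-leaf-03's fibre predicate `∀ i, x_i ∕ L^{n+1} = y_i` — one line, so that (D-P)k's supplier
  `B9Eq324PenaltyBlockLocal.norm_laplacePrimeAk_sub_covLaplace_apply_le_block_diagonal` inhabits `hP` below); **`kato_form_GpOfUk`** (EXPORTED; the tower
  twin of `B9Eq342GreenPrimeSupBoundDecay.kato_form_GpOfU`, which `B9Eq342GreenPrimeTowerSupBound` derives inline only): with `u = G′_k(U)f`,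
  `q = (Δ′_{a′,k}(U) − Δ^η_U)u = a′Q̃′_k(U)†Q̃′_k(U)u`: `Σ_{j ∈ Fin d ⊕ Fin d} η⁻²·(u(y) − T_{yj}u(nbr(y,j))) = f(y) − q(y)`.
* §1 **`norm_GpOfUk_apply_le_decay`**: the decayed value row for a one-big-block source, letters DISPLAYED: (T) `hR`∕`hS` contractive transporters;
  the (K1) big-block family `hPS` (inhabited for any map by `B9Eq349BlockMultipliers.exists_block_clm_family`); (D-P)k `hP : ‖((Δ′_{a′,k}(U) − Δ^η_U)v)(x)‖
  ≤ p₂‖P_{Πx}v‖` (ne9-leaf-03's (D) §2, `p₂ = |a′|∕√c₁` on the diagonal `c₀(L^{n+1})^d = c₁`); (D-E)k `hdec : ‖P_y ∘L G′_k(U) ∘L P_v‖ ≤ C_E·e^{−κ·d_m(v,y)}`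
  — the big-block `L²` decay of `G′_k(U)`, DISPLAYED here (road B8″'s `B9Eq349ConjugatedGreenBlockDecay.exists_block_decay_Gp` is the ONE-STEP
  statement; its tower twin in exactly this currency is ne9-leaf-03 g74's `B9Eq349ConjugatedGreenBlockDecayTower.exists_block_decay_GpOfUk`, consumed in
  `B9Eq342GreenPrimeTowerSupBoundDecayClosed`); (W) `hW0`, `hx₀`, `hsup` (a supersolution `λW ≤ (L₀+1)W` of the flat `η⁻²`-stencil in the
  `Sum.elim unshift shift` graph form) and `hWd : e^{κ₁·d_m(Πx₀,Πx)} ≤ M·W(x)`; (D-FS) `hDFS` (the decayed free letter at `x₀` for `k`-chains, constant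
  `C₃`); rates `0 ≤ κ′ ≤ κ`, `2κ′ < κ₁`; data `‖f(y)‖ ≤ F`, `‖f‖ ≤ √μF`.  PROOF = `norm_apply_le_decay_of_letters` at `X := TSite d (towerP L m (n+1))`,
  `Y := TSite d m`, `π := Π`, `δ := d_m`, `G := G′_k(U)`, `m₀ := 1`, `hu := kato_form_GpOfUk`, `S := K_d(κ₁−2κ′)` (`torusSum_le` on `T_m`).
* §2 **`norm_GpOfUk_apply_le_rowSum`** (EVERY `f`; `f = Σ_vP_vf`, §1 per big block, `torusSum_le`) and **`…_rowSum_unitary`** ((T) inhabited on the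
  chain's class: unitary `U`, `*`-trace, compatible fibre norm).
WHY «HEIGHT-FREE» IS A STATEMENT ABOUT THE INHABITANTS, NOT THIS FILE: every constant here is a displayed letter; the junction file
`B9Eq342GreenPrimeTowerSupBoundDecayCosh` inhabits (W)∕(D-FS) with `κ₁ = a⋆L^{n+1} ≥ 1∕√(4d+1)`, `M ≤ 2√e`, `λ ≥ 1∕2`, `C₃ = √(3^d∕c₁·λ^{−k})`,
`μ = c₁`, `p₂ = |a′|∕√c₁` — all free of `n` and of the volume `m`; what then remains displayed is (D-E)k with ITS `C_E, κ`.
HONEST SCOPE.  VALUE row only (no ∇-row, no Hölder rows (3.40), no (3.43)–(3.47), no random walk); «NE9 ⇐ the named binders»; NE9 NOT PRINTED ∕ NOT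
PROVED; row WALLED ON A MODEL (O-NE9-1; NEEDS-COORDINATOR #5 UNRULED); spine PROVED 0∕9; rung (B)+1 on a finite T⁴ — NOT infinite volume, NOT mass gap, NOT
BetaPertH, NOT Clay.  HONEST DEPENDENCY: continuum YM on T⁴ ⇐ BetaPertH ∧ nine spine estimates (0/9 proved); BetaPertH ⇐ (D1) ∧ (D4) ∧ CAP+tail; G-an2-4
gates asym, D1 and NE2/3/4.  NEW file; nothing modified.  Net new unproved facts: 0.
-/

noncomputable section

open scoped InnerProductSpace ComplexConjugate BigOperators

namespace Literature.MathematicalPhysics.QuantumFieldTheory.Balaban1983to89.B9Eq342GreenPrimeTowerSupBoundDecay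

open B4Sect5Torus (TSite tdist tdist_nonneg tdist_triangle tdist_symm torusSum_le)
open B4Sect5Proof (latticeConst)
open B9SectCLatticeCarrier (Bond shift unshift)
open B9Eq311L2Pairing (WL2)
open B11Eq103H1Complex (SiteL2K covLaplaceSiteK apply_greenK)
open B9Eq310HessianOperator (adTransportW)
open B9Eq319QprimeTorus (fineP blockCoord)
open B9Eq315QTower (towerP)
open B9Eq316TowerFlatIsOneStep (towerP_eq_fineP_pow siteCast)
open B9Eq324DeltaPrimeATower (laplacePrimeAk GpOfUk)
open B9Eq323KatoDomination (equiv_covLaplaceSiteK_eq_sum)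
open B9Eq342GreenPrimeSupBound (adTransportW_inv_adTransportW norm_adTransportW_eq norm_adTransportW_inv_eq)
open B9Eq349BlockMultipliers (sum_block_apply)
open B9Eq342SupNormDecayFromBlockDecay (block_apply_eq_self_of_support norm_apply_le_decay_of_letters)
open B9Eq342TowerBigBlocks (bigBlock_apply_val)

variable {d : ℕ} (L : ℕ) [NeZero L] (m : Fin d → ℕ) [∀ i, NeZero (m i)] (n : ℕ)
  {𝔸 : Type*} [NormedRing 𝔸] [NormedAlgebra ℂ 𝔸] [CompleteSpace 𝔸]
  {W : Type*} [NormedAddCommGroup W] [InnerProductSpace ℂ W] [FiniteDimensional ℂ W] (φ : W ≃ₗ[ℂ] 𝔸) {c₀ : ℝ} [Fact (0 < c₀)]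
  (η : ℝ) (U : Bond d (towerP L m (n + 1)) → 𝔸ˣ) {c₁ : ℝ} [Fact (0 < c₁)] (a' : ℝ)
  (hpos' : ∀ x : SiteL2K ℂ d (towerP L m (n + 1)) c₀ W, x ≠ 0 → 0 < RCLike.re ⟪x, laplacePrimeAk L m n φ η U a' (c₁ := c₁) x⟫_ℂ)

/-! ## §0 Bookkeeping: the big-block map versus the fibre predicate; `G′_k(U)f` in Kato form -/

omit [NeZero L] [∀ i, NeZero (m i)] in
/-- **THE BIG-BLOCK MAP VERSUS THE FIBRE PREDICATE**: `Πx = y ↔ ∀ i, x_i ∕ L^{n+1} = y_i` for `Π = blockCoord (L^{n+1}) m ∘ siteCast` (ne9-leaf-03's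
`B9Eq342TowerBigBlocks.bigBlock_apply_val` versus `B9Eq324PenaltyBlockLocal`'s fibre predicate) — print's «x ∈ Δ(y)». [folklore]
[cite: Balaban1985BackgroundPropagators, (3.19) p.393, (3.49) p.399] -/
theorem bigBlock_eq_iff (x : TSite d (towerP L m (n + 1))) (y : TSite d m) :
    blockCoord (L ^ (n + 1)) m (siteCast (towerP_eq_fineP_pow L m (n + 1)) x) = y ↔ ∀ i, (x i : ℕ) / L ^ (n + 1) = (y i : ℕ) := by
  constructor
  · intro h i
    rw [← h, bigBlock_apply_val]
  · intro h
    funext i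
    exact Fin.ext (by rw [bigBlock_apply_val]; exact h i)

/-- **`G′_k(U)f` IN KATO FORM** (the `hu` of every bootstrap of the programme at the tower, exported): with `u = G′_k(U)f`,
`q = (Δ′_{a′,k}(U) − Δ^η_U)u = a′Q̃′_k(U)†Q̃′_k(U)u` and the transporters `T_{y,μ} = R(U(y−e_μ,μ)⁻¹)` on the backward, `R(U(y,μ))` on the forward neighbours:
`Σ_{j ∈ Fin d ⊕ Fin d} η⁻²·(u(y) − T_{yj}u(nbr(y,j))) = f(y) − q(y)` — (3.23) `Δ^η_U = D*_U D_U` in the weighted-graph form of `B9Eq323KatoDomination` §3 and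
`Δ′_{a′,k}(U)u = f` (the tower twin of `B9Eq342GreenPrimeSupBoundDecay.kato_form_GpOfU`). [cite: Balaban1985BackgroundPropagators, (3.23)–(3.25) p.394, (3.19) p.393] -/
theorem kato_form_GpOfUk (f : SiteL2K ℂ d (towerP L m (n + 1)) c₀ W) (y : TSite d (towerP L m (n + 1))) :
    ∑ j : Fin d ⊕ Fin d, (RCLike.ofReal ((η⁻¹) ^ 2) : ℂ) •
        (WL2.equiv ℂ _ W (GpOfUk L m n φ η U a' hpos' f) y -
          (Sum.elim (fun μ => adTransportW φ (fun b => (U b)⁻¹) (unshift μ y, μ)) (fun μ => adTransportW φ U (y, μ)) j :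
              W →ₗ[ℂ] W)
            (WL2.equiv ℂ _ W (GpOfUk L m n φ η U a' hpos' f) (Sum.elim (fun μ => unshift μ y) (fun μ => shift μ y) j))) =
      WL2.equiv ℂ _ W f y -
        WL2.equiv ℂ _ W (laplacePrimeAk L m n φ η U a' (c₁ := c₁) (GpOfUk L m n φ η U a' hpos' f) -
          covLaplaceSiteK ((η : ℂ))⁻¹ (adTransportW φ U) (adTransportW φ fun b => (U b)⁻¹) (GpOfUk L m n φ η U a' hpos' f)) y := by
  set u : SiteL2K ℂ d (towerP L m (n + 1)) c₀ W := GpOfUk L m n φ η U a' hpos' f with hu_def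
  set q : SiteL2K ℂ d (towerP L m (n + 1)) c₀ W := laplacePrimeAk L m n φ η U a' (c₁ := c₁) u -
    covLaplaceSiteK ((η : ℂ))⁻¹ (adTransportW φ U) (adTransportW φ fun b => (U b)⁻¹) u with hq_def
  have hsol : laplacePrimeAk L m n φ η U a' (c₁ := c₁) u = f := by rw [hu_def]; exact apply_greenK hpos' f
  have hsplit : covLaplaceSiteK ((η : ℂ))⁻¹ (adTransportW φ U) (adTransportW φ fun b => (U b)⁻¹) u = f - q := by
    rw [hq_def, hsol]; abel
  have hcast : ((η : ℂ))⁻¹ = (RCLike.ofReal (η⁻¹) : ℂ) := (Complex.ofReal_inv η).symm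
  rw [hcast] at hsplit
  have h := congr_arg (fun g => WL2.equiv ℂ _ W g y) hsplit
  simp only [WL2.equiv_sub, Pi.sub_apply] at h
  rw [equiv_covLaplaceSiteK_eq_sum (η⁻¹) _ _ (adTransportW_inv_adTransportW φ U) u y] at h
  rw [← h, Fintype.sum_sum_type, ← Finset.sum_add_distrib]
  refine Finset.sum_congr rfl fun μ _ => ?_
  rw [← smul_add]; rfl

/-! ## §1 (3.42), first entry WITH DECAY, at `k = n+1` levels, for `G′_k(U)` and a one-big-block source -/

/-- **THE VALUE ROW OF (3.42) WITH ITS DECAY FACTOR AT `k = n+1` LEVELS FOR PRINT's `G′_k(U)`, CLOSED FORM IN THE DISPLAYED LETTERS.**  Letters: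
(T) contractive transporters; the (K1) family `P_y` of the BIG blocks (`Π = blockCoord (L^{n+1}) m ∘ siteCast`); (D-P)k the BIG-BLOCK-LOCAL penalty
`‖((Δ′_{a′,k}(U) − Δ^η_U)v)(x)‖ ≤ p₂‖P_{Πx}v‖`; (D-E)k the big-block decay `‖P_y∘G′_k(U)∘P_v‖ ≤ C_E·e^{−κd_m(v,y)}` of the source block `v`; (W) a weight `W > 0`
with `W(x₀) = 1`, supersolution `λW ≤ (L₀+1)W` for the flat `η⁻²`-stencil, domination `e^{κ₁d_m(Πx₀,Πx)} ≤ M·W(x)`; (D-FS) the decayed free letter at `x₀`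
against `W` with constant `C₃` for `k`-chains; rates `0 ≤ κ′ ≤ κ`, `2κ′ < κ₁`; data `f` supported in `B^k(v)` with `‖f(y)‖ ≤ F`, `‖f‖ ≤ √μF`.  Then
`‖(G′_k(U)f)(x₀)‖ ≤ ((1 + p₂C_E√μ)·M·(Σ_{l<k}λ^{−(l+1)}) + C₃·√(M·K_d(κ₁−2κ′))·C_E·√μ)·e^{−κ′d_m(Πx₀,v)}·F` — ne9-leaf-06's `norm_apply_le_decay_of_letters` at
`X = T_{(L^{n+1}m)}`, `Y = T_m`, `π = Π`, `δ = d_m`, `G = G′_k(U)`, `m₀ = 1`, `hu = kato_form_GpOfUk`, `S = K_d(κ₁−2κ′)`.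
[cite: Balaban1985BackgroundPropagators, Thm 3.1 (3.42) p.397, (3.24)–(3.25) p.394, (3.19) p.393, (3.49) p.399] -/
theorem norm_GpOfUk_apply_le_decay
    (hR : ∀ b w, ‖adTransportW φ U b w‖ ≤ ‖w‖) (hS : ∀ b w, ‖adTransportW φ (fun b => (U b)⁻¹) b w‖ ≤ ‖w‖)
    {PS : TSite d m → SiteL2K ℂ d (towerP L m (n + 1)) c₀ W →L[ℂ] SiteL2K ℂ d (towerP L m (n + 1)) c₀ W}
    (hPS : ∀ (y : TSite d m) (g : SiteL2K ℂ d (towerP L m (n + 1)) c₀ W) (x : TSite d (towerP L m (n + 1))),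
      WL2.equiv ℂ (fun _ : TSite d (towerP L m (n + 1)) => c₀) W (PS y g) x =
        if blockCoord (L ^ (n + 1)) m (siteCast (towerP_eq_fineP_pow L m (n + 1)) x) = y then
          WL2.equiv ℂ (fun _ : TSite d (towerP L m (n + 1)) => c₀) W g x else 0)
    {p₂ CE C₃ M lam κ κ₁ κ' : ℝ} (hp₂ : 0 ≤ p₂) (hCE : 0 ≤ CE) (hC₃ : 0 ≤ C₃) (hM : 0 ≤ M) (hlam : 0 < lam)
    (hκ' : 0 ≤ κ') (hκ : κ' ≤ κ) (hκ₁ : 2 * κ' < κ₁)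
    (hP : ∀ (v : SiteL2K ℂ d (towerP L m (n + 1)) c₀ W) (x : TSite d (towerP L m (n + 1))),
      ‖WL2.equiv ℂ _ W (laplacePrimeAk L m n φ η U a' (c₁ := c₁) v -
        covLaplaceSiteK ((η : ℂ))⁻¹ (adTransportW φ U) (adTransportW φ fun b => (U b)⁻¹) v) x‖ ≤
        p₂ * ‖PS (blockCoord (L ^ (n + 1)) m (siteCast (towerP_eq_fineP_pow L m (n + 1)) x)) v‖)
    {v : TSite d m}
    (hdec : ∀ y : TSite d m, ‖PS y ∘L LinearMap.toContinuousLinearMap (GpOfUk L m n φ η U a' hpos') ∘L PS v‖ ≤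
      CE * Real.exp (-(κ * tdist m v y)))
    {x₀ : TSite d (towerP L m (n + 1))} {Wt : TSite d (towerP L m (n + 1)) → ℝ} (hW0 : ∀ x, 0 < Wt x) (hx₀ : Wt x₀ = 1)
    (hsup : ∀ x, lam * Wt x ≤
      ∑ j : Fin d ⊕ Fin d, (η⁻¹) ^ 2 * (Wt x - Wt (Sum.elim (fun μ => unshift μ x) (fun μ => shift μ x) j)) + 1 * Wt x)
    (hWd : ∀ x, Real.exp (κ₁ * tdist m (blockCoord (L ^ (n + 1)) m (siteCast (towerP_eq_fineP_pow L m (n + 1)) x₀))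
      (blockCoord (L ^ (n + 1)) m (siteCast (towerP_eq_fineP_pow L m (n + 1)) x))) ≤ M * Wt x) {k : ℕ}
    (hDFS : ∀ ψ : ℕ → TSite d (towerP L m (n + 1)) → ℝ, (∀ y, 0 ≤ ψ 0 y) → (∀ j < k, ∀ x, ∑ i : Fin d ⊕ Fin d,
        (η⁻¹) ^ 2 * (ψ (j + 1) x - ψ (j + 1) (Sum.elim (fun μ => unshift μ x) (fun μ => shift μ x) i)) + 1 * ψ (j + 1) x = ψ j x) →
      ψ k x₀ ≤ C₃ * Real.sqrt (∑ y, c₀ * ψ 0 y ^ 2 / Wt y))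
    (f : SiteL2K ℂ d (towerP L m (n + 1)) c₀ W)
    (hfv : ∀ x, blockCoord (L ^ (n + 1)) m (siteCast (towerP_eq_fineP_pow L m (n + 1)) x) ≠ v → WL2.equiv ℂ _ W f x = 0)
    {F μ : ℝ} (hF : ∀ y, ‖WL2.equiv ℂ _ W f y‖ ≤ F) (hμ : ‖f‖ ≤ Real.sqrt μ * F) :
    ‖WL2.equiv ℂ _ W (GpOfUk L m n φ η U a' hpos' f) x₀‖ ≤
      ((1 + p₂ * CE * Real.sqrt μ) * M * (∑ l ∈ Finset.range k, (lam ^ (l + 1))⁻¹) +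
        C₃ * Real.sqrt (M * latticeConst d (κ₁ - 2 * κ')) * CE * Real.sqrt μ) *
        Real.exp (-(κ' * tdist m (blockCoord (L ^ (n + 1)) m (siteCast (towerP_eq_fineP_pow L m (n + 1)) x₀)) v)) * F := by
  have hm : ∀ i, 1 ≤ m i := fun i => Nat.one_le_iff_ne_zero.mpr (NeZero.ne (m i))
  set G : SiteL2K ℂ d (towerP L m (n + 1)) c₀ W →L[ℂ] SiteL2K ℂ d (towerP L m (n + 1)) c₀ W :=
    LinearMap.toContinuousLinearMap (GpOfUk L m n φ η U a' (c₁ := c₁) hpos')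
  have hGf : G f = GpOfUk L m n φ η U a' hpos' f := rfl
  -- the solution and the penalty term
  set u : SiteL2K ℂ d (towerP L m (n + 1)) c₀ W := GpOfUk L m n φ η U a' hpos' f
  set q : SiteL2K ℂ d (towerP L m (n + 1)) c₀ W := laplacePrimeAk L m n φ η U a' (c₁ := c₁) u -
    covLaplaceSiteK ((η : ℂ))⁻¹ (adTransportW φ U) (adTransportW φ fun b => (U b)⁻¹) u
  -- the weighted graph of (3.23) and its contractive transporters
  let nbr : TSite d (towerP L m (n + 1)) → Fin d ⊕ Fin d → TSite d (towerP L m (n + 1)) :=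
    fun y j => Sum.elim (fun μ => unshift μ y) (fun μ => shift μ y) j
  let T : TSite d (towerP L m (n + 1)) → Fin d ⊕ Fin d → W →ₗ[ℂ] W :=
    fun y j => Sum.elim (fun μ => adTransportW φ (fun b => (U b)⁻¹) (unshift μ y, μ)) (fun μ => adTransportW φ U (y, μ)) j
  have hT : ∀ y j z, ‖T y j z‖ ≤ ‖z‖ := fun y j z => by
    rcases j with μ | μ
    · exact hS _ z
    · exact hR _ z
  have hu : ∀ y, ∑ j, (RCLike.ofReal ((fun (_ : TSite d (towerP L m (n + 1))) (_ : Fin d ⊕ Fin d) => (η⁻¹) ^ 2) y j) : ℂ) •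
      (WL2.equiv ℂ _ W (G f) y - T y j (WL2.equiv ℂ _ W (G f) (nbr y j))) = WL2.equiv ℂ _ W f y - WL2.equiv ℂ _ W q y := by
    intro y
    rw [hGf]
    exact kato_form_GpOfUk L m n φ η U a' hpos' (c₁ := c₁) f y
  -- the block-local penalty letter at the solution
  have hq : ∀ x, ‖WL2.equiv ℂ _ W q x‖ ≤ p₂ * ‖PS (blockCoord (L ^ (n + 1)) m (siteCast (towerP_eq_fineP_pow L m (n + 1)) x)) (G f)‖ :=
    fun x => by rw [hGf]; exact hP u x
  -- (D-E)k read output-first for the abstract composition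
  have hdec' : ∀ y : TSite d m, ‖PS y ∘L G ∘L PS v‖ ≤ CE * Real.exp (-(κ * tdist m y v)) := fun y => by
    have h := hdec y; rwa [tdist_symm hm v y] at h
  have hF0 : 0 ≤ F := (norm_nonneg _).trans (hF x₀)
  have haκ₁ : κ' ≤ κ₁ := by linarith
  -- the composition
  have h := norm_apply_le_decay_of_letters (𝕜 := ℂ) (P := PS)
    (π := fun x : TSite d (towerP L m (n + 1)) => blockCoord (L ^ (n + 1)) m (siteCast (towerP_eq_fineP_pow L m (n + 1)) x))
    (δ := tdist m) hPS (tdist_nonneg m) (tdist_triangle hm) nbr (fun _ _ => (η⁻¹) ^ 2) (fun _ _ => sq_nonneg _) T hT one_pos hW0 hlam hsup hx₀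
    hM hWd G hfv hF0 hF hμ hCE hdec' hu hp₂ hq hC₃ hDFS hκ' hκ haκ₁ (fun y => torusSum_le d hm (sub_pos.mpr hκ₁) y)
  rw [hGf] at h
  refine h.trans (le_of_eq ?_)
  have hgeom : M * (1 + p₂ * CE * Real.sqrt μ) / lam * ∑ l ∈ Finset.range k, (1 / lam) ^ l =
      (1 + p₂ * CE * Real.sqrt μ) * M * ∑ l ∈ Finset.range k, (lam ^ (l + 1))⁻¹ := by
    rw [Finset.mul_sum, Finset.mul_sum]
    refine Finset.sum_congr rfl fun l _ => ?_
    rw [one_div, inv_pow, pow_succ, mul_inv]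
    ring
  rw [hgeom, one_pow, one_mul]
  ring

/-! ## §2 The row sum over the source big blocks: the `L^∞ → L^∞` bound of `G′_k(U)` -/

omit [NeZero L] [∀ i, NeZero (m i)] [FiniteDimensional ℂ W] [Fact (0 < c₀)] in
/-- the identification commutes with finite sums, pointwise (private helper). [folklore] -/
private theorem equiv_sum {ι : Type*} (s : Finset ι) (g : ι → SiteL2K ℂ d (towerP L m (n + 1)) c₀ W) (x : TSite d (towerP L m (n + 1))) :
    WL2.equiv ℂ _ W (∑ i ∈ s, g i) x = ∑ i ∈ s, WL2.equiv ℂ _ W (g i) x := by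
  have e := congrFun (map_sum (WL2.linearEquiv ℂ ℂ (fun _ : TSite d (towerP L m (n + 1)) => c₀) (V := W)) g s) x
  simp only [WL2.linearEquiv_apply, Finset.sum_apply] at e
  exact e

/-- **THE ROW SUM OF (3.42) AT `k = n+1` LEVELS: `‖(G′_k(U)f)(x₀)‖ ≤ (B₁ + B₂)·K_d(κ′)·sup|f|` FOR EVERY `f`** (no support hypothesis): decompose
`f = Σ_v P_vf` over the BIG blocks (`B9Eq349BlockMultipliers.sum_block_apply`), apply §1 to each piece (`‖(P_vf)(x)‖ ≤ F`, one-block masses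
`‖P_vf‖ ≤ √μF` — the letter `hμ`, `μ = c₀(L^{n+1})^d = c₁` on the diagonal by ne9-leaf-03's `B9Eq324PenaltyBlockLocal.norm_block_le_sqrt_mul_tower`), and sum
the decay factors over `T_m` with `B4Sect5Torus.torusSum_le` (`Σ_v e^{−κ′d_m(Πx₀,v)} ≤ K_d(κ′)`, VOLUME-FREE; `0 < κ′`).  This is the `L^∞`-operator form the
(N)-reading consumes (`B9Eq347GlobalFromLocal` ∕ `B11Eq115KernelOp.norm_kernelCLM_le_of_rowSum_le`).
[cite: Balaban1985BackgroundPropagators, Thm 3.1 (3.42) p.397, (3.39) p.397, (3.49) p.399] -/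
theorem norm_GpOfUk_apply_le_rowSum
    (hR : ∀ b w, ‖adTransportW φ U b w‖ ≤ ‖w‖) (hS : ∀ b w, ‖adTransportW φ (fun b => (U b)⁻¹) b w‖ ≤ ‖w‖)
    {PS : TSite d m → SiteL2K ℂ d (towerP L m (n + 1)) c₀ W →L[ℂ] SiteL2K ℂ d (towerP L m (n + 1)) c₀ W}
    (hPS : ∀ (y : TSite d m) (g : SiteL2K ℂ d (towerP L m (n + 1)) c₀ W) (x : TSite d (towerP L m (n + 1))),
      WL2.equiv ℂ (fun _ : TSite d (towerP L m (n + 1)) => c₀) W (PS y g) x =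
        if blockCoord (L ^ (n + 1)) m (siteCast (towerP_eq_fineP_pow L m (n + 1)) x) = y then
          WL2.equiv ℂ (fun _ : TSite d (towerP L m (n + 1)) => c₀) W g x else 0)
    {p₂ CE C₃ M lam κ κ₁ κ' : ℝ} (hp₂ : 0 ≤ p₂) (hCE : 0 ≤ CE) (hC₃ : 0 ≤ C₃) (hM : 0 ≤ M) (hlam : 0 < lam)
    (hκ' : 0 < κ') (hκ : κ' ≤ κ) (hκ₁ : 2 * κ' < κ₁)
    (hP : ∀ (v : SiteL2K ℂ d (towerP L m (n + 1)) c₀ W) (x : TSite d (towerP L m (n + 1))),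
      ‖WL2.equiv ℂ _ W (laplacePrimeAk L m n φ η U a' (c₁ := c₁) v -
        covLaplaceSiteK ((η : ℂ))⁻¹ (adTransportW φ U) (adTransportW φ fun b => (U b)⁻¹) v) x‖ ≤
        p₂ * ‖PS (blockCoord (L ^ (n + 1)) m (siteCast (towerP_eq_fineP_pow L m (n + 1)) x)) v‖)
    (hdec : ∀ v y : TSite d m, ‖PS y ∘L LinearMap.toContinuousLinearMap (GpOfUk L m n φ η U a' hpos') ∘L PS v‖ ≤
      CE * Real.exp (-(κ * tdist m v y)))
    {x₀ : TSite d (towerP L m (n + 1))} {Wt : TSite d (towerP L m (n + 1)) → ℝ} (hW0 : ∀ x, 0 < Wt x) (hx₀ : Wt x₀ = 1)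
    (hsup : ∀ x, lam * Wt x ≤
      ∑ j : Fin d ⊕ Fin d, (η⁻¹) ^ 2 * (Wt x - Wt (Sum.elim (fun μ => unshift μ x) (fun μ => shift μ x) j)) + 1 * Wt x)
    (hWd : ∀ x, Real.exp (κ₁ * tdist m (blockCoord (L ^ (n + 1)) m (siteCast (towerP_eq_fineP_pow L m (n + 1)) x₀))
      (blockCoord (L ^ (n + 1)) m (siteCast (towerP_eq_fineP_pow L m (n + 1)) x))) ≤ M * Wt x) {k : ℕ}
    (hDFS : ∀ ψ : ℕ → TSite d (towerP L m (n + 1)) → ℝ, (∀ y, 0 ≤ ψ 0 y) → (∀ j < k, ∀ x, ∑ i : Fin d ⊕ Fin d,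
        (η⁻¹) ^ 2 * (ψ (j + 1) x - ψ (j + 1) (Sum.elim (fun μ => unshift μ x) (fun μ => shift μ x) i)) + 1 * ψ (j + 1) x = ψ j x) →
      ψ k x₀ ≤ C₃ * Real.sqrt (∑ y, c₀ * ψ 0 y ^ 2 / Wt y))
    (f : SiteL2K ℂ d (towerP L m (n + 1)) c₀ W) {F μ : ℝ} (hF : ∀ y, ‖WL2.equiv ℂ _ W f y‖ ≤ F) (hμ : ∀ v, ‖PS v f‖ ≤ Real.sqrt μ * F) :
    ‖WL2.equiv ℂ _ W (GpOfUk L m n φ η U a' hpos' f) x₀‖ ≤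
      ((1 + p₂ * CE * Real.sqrt μ) * M * (∑ l ∈ Finset.range k, (lam ^ (l + 1))⁻¹) +
        C₃ * Real.sqrt (M * latticeConst d (κ₁ - 2 * κ')) * CE * Real.sqrt μ) * latticeConst d κ' * F := by
  classical
  have hm : ∀ i, 1 ≤ m i := fun i => Nat.one_le_iff_ne_zero.mpr (NeZero.ne (m i))
  set B : ℝ := (1 + p₂ * CE * Real.sqrt μ) * M * (∑ l ∈ Finset.range k, (lam ^ (l + 1))⁻¹) +
    C₃ * Real.sqrt (M * latticeConst d (κ₁ - 2 * κ')) * CE * Real.sqrt μ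
  have hF0 : 0 ≤ F := (norm_nonneg _).trans (hF x₀)
  have hB0 : 0 ≤ B :=
    add_nonneg (mul_nonneg (mul_nonneg (by positivity) hM) (Finset.sum_nonneg fun l _ => inv_nonneg.2 (pow_nonneg hlam.le _)))
      (by positivity)
  -- each one-big-block piece `P_vf`
  have hpiece : ∀ v : TSite d m, ‖WL2.equiv ℂ _ W (GpOfUk L m n φ η U a' hpos' (PS v f)) x₀‖ ≤
      B * Real.exp (-(κ' * tdist m (blockCoord (L ^ (n + 1)) m (siteCast (towerP_eq_fineP_pow L m (n + 1)) x₀)) v)) * F := fun v => by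
    have hfv : ∀ x, blockCoord (L ^ (n + 1)) m (siteCast (towerP_eq_fineP_pow L m (n + 1)) x) ≠ v →
        WL2.equiv ℂ _ W (PS v f) x = 0 := fun x hx => by
      rw [hPS, if_neg hx]
    have hFv : ∀ y, ‖WL2.equiv ℂ _ W (PS v f) y‖ ≤ F := fun y => by
      rw [hPS]
      by_cases hy : blockCoord (L ^ (n + 1)) m (siteCast (towerP_eq_fineP_pow L m (n + 1)) y) = v
      · rw [if_pos hy]; exact hF y
      · rw [if_neg hy, norm_zero]; exact hF0
    exact norm_GpOfUk_apply_le_decay L m n φ η U a' hpos' (c₁ := c₁) hR hS hPS hp₂ hCE hC₃ hM hlam hκ'.le hκ hκ₁ hP (hdec v) hW0 hx₀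
      hsup hWd hDFS (PS v f) hfv hFv (hμ v)
  -- decompose and sum
  have hsplit : GpOfUk L m n φ η U a' hpos' f = ∑ v, GpOfUk L m n φ η U a' hpos' (PS v f) := by
    rw [← map_sum, sum_block_apply hPS f]
  calc ‖WL2.equiv ℂ _ W (GpOfUk L m n φ η U a' hpos' f) x₀‖
      = ‖∑ v, WL2.equiv ℂ _ W (GpOfUk L m n φ η U a' hpos' (PS v f)) x₀‖ := by rw [hsplit, equiv_sum]
    _ ≤ ∑ v, ‖WL2.equiv ℂ _ W (GpOfUk L m n φ η U a' hpos' (PS v f)) x₀‖ := norm_sum_le _ _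
    _ ≤ ∑ v, B * Real.exp (-(κ' * tdist m (blockCoord (L ^ (n + 1)) m (siteCast (towerP_eq_fineP_pow L m (n + 1)) x₀)) v)) * F :=
        Finset.sum_le_sum fun v _ => hpiece v
    _ = B * F * ∑ v, Real.exp (-(κ' * tdist m (blockCoord (L ^ (n + 1)) m (siteCast (towerP_eq_fineP_pow L m (n + 1)) x₀)) v)) := by
        rw [Finset.mul_sum]; exact Finset.sum_congr rfl fun v _ => by ring
    _ ≤ B * F * latticeConst d κ' :=
        mul_le_mul_of_nonneg_left (torusSum_le d hm hκ' _) (mul_nonneg hB0 hF0)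
    _ = B * latticeConst d κ' * F := by ring

/-- **THE ROW SUM OF (3.42) AT `k` LEVELS ON THE CHAIN's CLASS, (T) INHABITED** (`[StarRing 𝔸]`): unitary `U`, `*`-trace, compatible fibre norm (the
chain's standing letters `hU`, `hτ₂`, `hφ` — `B9Eq342GreenPrimeSupBound` §0) in place of the contraction binders; letters (D-P)k, (D-E)k, (W), (D-FS),
(supp) as in `norm_GpOfUk_apply_le_rowSum`. [cite: Balaban1985BackgroundPropagators, Thm 3.1 (3.42) p.397, (3.39) p.397] -/
theorem norm_GpOfUk_apply_le_rowSum_unitary [StarRing 𝔸] (τ : 𝔸 →ₗ[ℂ] ℂ) (hτ₂ : ∀ X Y : 𝔸, τ (X * Y) = τ (Y * X))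
    (hU : ∀ b, star (U b : 𝔸) = ((U b)⁻¹ : 𝔸ˣ)) (hφ : ∀ X Y : 𝔸, ⟪φ.symm X, φ.symm Y⟫_ℂ = τ (star X * Y))
    {PS : TSite d m → SiteL2K ℂ d (towerP L m (n + 1)) c₀ W →L[ℂ] SiteL2K ℂ d (towerP L m (n + 1)) c₀ W}
    (hPS : ∀ (y : TSite d m) (g : SiteL2K ℂ d (towerP L m (n + 1)) c₀ W) (x : TSite d (towerP L m (n + 1))),
      WL2.equiv ℂ (fun _ : TSite d (towerP L m (n + 1)) => c₀) W (PS y g) x =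
        if blockCoord (L ^ (n + 1)) m (siteCast (towerP_eq_fineP_pow L m (n + 1)) x) = y then
          WL2.equiv ℂ (fun _ : TSite d (towerP L m (n + 1)) => c₀) W g x else 0)
    {p₂ CE C₃ M lam κ κ₁ κ' : ℝ} (hp₂ : 0 ≤ p₂) (hCE : 0 ≤ CE) (hC₃ : 0 ≤ C₃) (hM : 0 ≤ M) (hlam : 0 < lam)
    (hκ' : 0 < κ') (hκ : κ' ≤ κ) (hκ₁ : 2 * κ' < κ₁)
    (hP : ∀ (v : SiteL2K ℂ d (towerP L m (n + 1)) c₀ W) (x : TSite d (towerP L m (n + 1))),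
      ‖WL2.equiv ℂ _ W (laplacePrimeAk L m n φ η U a' (c₁ := c₁) v -
        covLaplaceSiteK ((η : ℂ))⁻¹ (adTransportW φ U) (adTransportW φ fun b => (U b)⁻¹) v) x‖ ≤
        p₂ * ‖PS (blockCoord (L ^ (n + 1)) m (siteCast (towerP_eq_fineP_pow L m (n + 1)) x)) v‖)
    (hdec : ∀ v y : TSite d m, ‖PS y ∘L LinearMap.toContinuousLinearMap (GpOfUk L m n φ η U a' hpos') ∘L PS v‖ ≤
      CE * Real.exp (-(κ * tdist m v y)))
    {x₀ : TSite d (towerP L m (n + 1))} {Wt : TSite d (towerP L m (n + 1)) → ℝ} (hW0 : ∀ x, 0 < Wt x) (hx₀ : Wt x₀ = 1)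
    (hsup : ∀ x, lam * Wt x ≤
      ∑ j : Fin d ⊕ Fin d, (η⁻¹) ^ 2 * (Wt x - Wt (Sum.elim (fun μ => unshift μ x) (fun μ => shift μ x) j)) + 1 * Wt x)
    (hWd : ∀ x, Real.exp (κ₁ * tdist m (blockCoord (L ^ (n + 1)) m (siteCast (towerP_eq_fineP_pow L m (n + 1)) x₀))
      (blockCoord (L ^ (n + 1)) m (siteCast (towerP_eq_fineP_pow L m (n + 1)) x))) ≤ M * Wt x) {k : ℕ}
    (hDFS : ∀ ψ : ℕ → TSite d (towerP L m (n + 1)) → ℝ, (∀ y, 0 ≤ ψ 0 y) → (∀ j < k, ∀ x, ∑ i : Fin d ⊕ Fin d,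
        (η⁻¹) ^ 2 * (ψ (j + 1) x - ψ (j + 1) (Sum.elim (fun μ => unshift μ x) (fun μ => shift μ x) i)) + 1 * ψ (j + 1) x = ψ j x) →
      ψ k x₀ ≤ C₃ * Real.sqrt (∑ y, c₀ * ψ 0 y ^ 2 / Wt y))
    (f : SiteL2K ℂ d (towerP L m (n + 1)) c₀ W) {F μ : ℝ} (hF : ∀ y, ‖WL2.equiv ℂ _ W f y‖ ≤ F) (hμ : ∀ v, ‖PS v f‖ ≤ Real.sqrt μ * F) :
    ‖WL2.equiv ℂ _ W (GpOfUk L m n φ η U a' hpos' f) x₀‖ ≤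
      ((1 + p₂ * CE * Real.sqrt μ) * M * (∑ l ∈ Finset.range k, (lam ^ (l + 1))⁻¹) +
        C₃ * Real.sqrt (M * latticeConst d (κ₁ - 2 * κ')) * CE * Real.sqrt μ) * latticeConst d κ' * F :=
  norm_GpOfUk_apply_le_rowSum L m n φ η U a' hpos' (fun b w => (norm_adTransportW_eq φ U τ hτ₂ hU hφ b w).le)
    (fun b w => (norm_adTransportW_inv_eq φ U τ hτ₂ hU hφ b w).le) hPS hp₂ hCE hC₃ hM hlam hκ' hκ hκ₁ hP hdec hW0 hx₀ hsup hWd hDFS f hF hμ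

end Literature.MathematicalPhysics.QuantumFieldTheory.Balaban1983to89.B9Eq342GreenPrimeTowerSupBoundDecay

end
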